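import Literature.MathematicalPhysics.QuantumFieldTheory.Balaban1983to89.B6GlobalChartV1
import Literature.MathematicalPhysics.QuantumFieldTheory.Balaban1983to89.B6ScalarChartV1
import Summits.QuantumFields.YangMills.Theorems.UnitScaleTiltProp8FlatCubeOpsText
import HarnessLib

/-!
# Route `UnitScaleTilt`, crux K1 child «MinimiserStabilityRegPr» (stmt-QuantumFields-19200), v8 pillar **P2 `stub_flatOpsCubeSeq`** — THE PORT BRIDGE, file 1:
# **EVERY ADMISSIBLE NESTED FAMILY OF THE P2 TEXT WITH `Ω₁ = T` IS lit-balaban's `domT` OF A TORUS FAMILY `TDomains`** (the chart under which the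
# hypothesis-free k-level rows [Balaban1984PropagatorsII] Prop. 2.6 / 2.7 / Cor. 2.8 of the `B6*KLevelV1` chain — and, the day they land, their `…L0` twins —
# are read on the P2 text's own families `D : B6SectADomainsV1.Domains (F.P K)` with `Adm22 D R M`)

Cell `ym3-torus` (HUMAN RULING D-0037, YM ladder rung R3), seat `ym3-torus-p1` gen 17.  `--supports stmt-QuantumFields-19200 --as helper`; count-neutral.

THE POINT.  The registered P2 text `FlatCubeOpsText.FlatOpsAdmAtMS` (p537056) quantifies over p21's V1 families `D : B6SectADomainsV1.Domains (F.P K)` with the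
(2.1)–(2.2) admissibility `FlatCubeOpsText.Adm22 D R M` (big blocks of `M` sites of `T^{(j)}`, separation `> R·M`); lit-balaban's k-level estimates
(`B6Cor28EntriesKLevelV1.cor28_kLevel_H_DH`, `B6Prop26*KLevelV1`, `B6Prop27KLevelV1`, …) are stated for the V1 datum `B6GlobalChartV1.domT hN D hk` of a TORUS
FAMILY `D : B6MultiLevelTorusOperator.TDomains d ℓ M_h k P′ R` (a level function on the fundamental box, big blocks `M = L·M_h`, (2.2) in the torus sup-distance).
THIS FILE is the dictionary between the two, for general `PV d ℓ m K` (the d = 3 carrier `F.P K` is the instance `PV 2 ℓ F.m K`, `F.L = ℓ + 1`, by `rfl`):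
* §1 the inverse chart `ofBox` of `B6GlobalChartV1.toBox` (`toBox_ofBox`, `ofBox_toBox`);
* §2 the level function `levV D x = max {j ≤ k : x ∈ Ω_j}` of a V1 family (`le_levV_iff : j ≤ levV D x ↔ x ∈ Ω_j`, `one_le_levV` when `Ω₁ = T`);
* §3 the REVERSE cross-level distance inequality `L·dist_{j+1}(B y, B c) ≤ dist_j(y, c) + (L − 1)` (companion of p1 g15's `FlatCubeSequence.distSite_le_blockOf`),
  iterated: `L^j·dist_j(B^j x, B^j x′) ≤ dist₀(x, x′) + (L^j − 1)`; and `dist₀ = torusSupNorm` of the chart points;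
* §4 **`tdOfAdm`**: an admissible V1 family (`Adm22 D R (L·M_h)`) with `Ω₁ = T` and `k ≥ 1` levels IS a torus family `TDomains d ℓ M_h k P′ R` (level function
  `levV ∘ ofBox`; (2.1) from `Adm22`'s block clause via `blk_toBox`; (2.2) from `Adm22`'s separation clause via §3), and **`domT_tdOfAdm : domT hN (tdOfAdm …) hk = D`**
  — so every k-level row of the lineage stated for `domT hN D′ hk` holds for `D` by `rw`.
HONEST SCOPE: bookkeeping (no estimate); `Ω₁ = T` is the lineage's standing restriction (gap G-F3′-L0: the `…L0` twins admit `Λ₀ ≠ ∅`; this file's §1–§3 are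
`Λ₀`-agnostic and §4 ports by deleting `one_le_lev`); the chart needs the lineage's size condition `hN : N0 ℓ M_h k P′ = sitesPerDir 0` (big blocks tile the torus).
NOT a claim about the mass gap.

References: T. Bałaban, CMP **96** (1984) 223–250 [Balaban1984PropagatorsII] (2.1)–(2.4) p.224, (2.46) p.231; CMP **102** (1985) 277–309 [Balaban1985Variational]
(144) p.300, (161)–(162) p.303.
-/

set_option autoImplicit false

noncomputable section

open scoped BigOperators

namespace Summit.QuantumFields.YangMills.Theorems.FlatPortChart

open Literature.MathematicalPhysics.QuantumFieldTheory.Balaban1983to89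
open B4Reflection242 (boxDom mem_boxDom blk)
open B4TorusKernel.MultiPeriod (torusSupNorm)
open B5Eq117TorusCarriers (Mk)
open B5Eq118OneStroke (iterBlockOf val_iterBlockOf iterBlockOf_succ iterBlockOf_zero)
open B5Prop12FieldsLattice (distSite distSite_self distSite_nonneg)
open B5RowSumsP12Lattice (distSite_comm)
open B6LowerBound2153Torus (rep)
open B6MultiLevelBoxOperator (N0 bigSide bigSide_eq)
open B6MultiLevelTorusOperator (TDomains)
open B6GlobalChartV1 (PV toBox toBox_apply toBox_injective blk_toBox domT)
open B6SectADomainsV1 (Domains)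
open B11Eq115Space (levOf levOf_le mem_levOf le_levOf)
open FlatCubeOpsText (Adm22)

variable {d ℓ m K : ℕ} {hd : 1 ≤ d + 1} {hL : Odd (ℓ + 1) ∧ 1 < ℓ + 1}

/-! ## §1 The inverse chart `Π_μ[0, N_μ) → T_η` -/

section Chart

variable {Mh k : ℕ} {P' : Fin (d + 1) → ℕ}

/-- the site of the V1 torus with label vector `z` (the inverse of `B6GlobalChartV1.toBox` on the fundamental box). [cite: Balaban1984PropagatorsII, (2.1) p.224, dictionary] -/
def ofBox (z : Fin (d + 1) → ℤ) : Site (PV d ℓ m K hd hL) 0 := fun μ => ((z μ : ℤ) : ZMod ((PV d ℓ m K hd hL).sitesPerDir 0))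

/-- labels of `ofBox z` for `z` in the fundamental box. [cite: Balaban1984PropagatorsII, (2.1) p.224, dictionary] -/
theorem val_ofBox (hN : ∀ μ, N0 ℓ Mh k P' μ = (PV d ℓ m K hd hL).sitesPerDir 0) {z : Fin (d + 1) → ℤ} (hz : z ∈ boxDom (N0 ℓ Mh k P'))
    (μ : Fin (d + 1)) : (((ofBox (m := m) (K := K) (hd := hd) (hL := hL) z) μ).val : ℤ) = z μ := by
  obtain ⟨h0, hlt⟩ := (mem_boxDom.1 hz) μ
  rw [hN μ] at hlt
  unfold ofBox
  rw [ZMod.val_intCast, Int.emod_eq_of_lt h0 hlt]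

/-- `toBox ∘ ofBox = id` on the fundamental box. [cite: Balaban1984PropagatorsII, (2.1) p.224, dictionary] -/
theorem toBox_ofBox (hN : ∀ μ, N0 ℓ Mh k P' μ = (PV d ℓ m K hd hL).sitesPerDir 0) (z : ↥(boxDom (N0 ℓ Mh k P'))) :
    toBox (m := m) (K := K) hN (ofBox z.1) = z :=
  Subtype.ext (funext fun μ => by rw [toBox_apply, val_ofBox hN z.2])

/-- `ofBox ∘ toBox = id`. [cite: Balaban1984PropagatorsII, (2.1) p.224, dictionary] -/
theorem ofBox_toBox (hN : ∀ μ, N0 ℓ Mh k P' μ = (PV d ℓ m K hd hL).sitesPerDir 0) (x : Site (PV d ℓ m K hd hL) 0) :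
    ofBox (toBox hN x : Fin (d + 1) → ℤ) = x := by
  funext μ
  unfold ofBox
  rw [toBox_apply, Int.cast_natCast, ZMod.natCast_zmod_val]

end Chart

/-! ## §2 The level function of a V1 family -/

section Level

variable (D : Domains (PV d ℓ m K hd hL))

/-- **`j(x)`** = the largest `j ≤ k` with `x ∈ Ω_j` (p. 224: `x ∈ Bʲ(Λ_j)` iff `j(x) = j`). [cite: Balaban1984PropagatorsII, (2.3)-(2.4) p.224] -/
def levV (x : Site (PV d ℓ m K hd hL) 0) : ℕ := levOf (fun j => {x : Site (PV d ℓ m K hd hL) 0 | D.InOm j x}) D.k x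

/-- `j(x) ≤ k`. [cite: Balaban1984PropagatorsII, (2.3)-(2.4) p.224] -/
theorem levV_le (x : Site (PV d ℓ m K hd hL) 0) : levV D x ≤ D.k := levOf_le _ _ _

/-- `x ∈ Ω_{j(x)}`. [cite: Balaban1984PropagatorsII, (2.3)-(2.4) p.224] -/
theorem inOm_levV (x : Site (PV d ℓ m K hd hL) 0) : D.InOm (levV D x) x :=
  mem_levOf (Ω := fun j => {x : Site (PV d ℓ m K hd hL) 0 | D.InOm j x}) (fun x => D.inOm_zero x) D.k x

/-- **`Ω_j = {j ≤ j(·)}`** (nesting (2.1)). [cite: Balaban1984PropagatorsII, (2.1)-(2.4) p.224] -/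
theorem le_levV_iff {j : ℕ} (hj : j ≤ D.k) (x : Site (PV d ℓ m K hd hL) 0) : j ≤ levV D x ↔ D.InOm j x :=
  ⟨fun h => D.inOm_of_le h (inOm_levV D x), fun h => le_levOf (Ω := fun j => {x : Site (PV d ℓ m K hd hL) 0 | D.InOm j x}) hj h⟩

/-- below the level: `x ∉ Ω_j` for `j(x) < j`. [cite: Balaban1984PropagatorsII, (2.1)-(2.4) p.224] -/
theorem not_inOm_of_levV_lt {j : ℕ} {x : Site (PV d ℓ m K hd hL) 0} (h : levV D x < j) : ¬ D.InOm j x := by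
  intro hx
  by_cases hj : j ≤ D.k
  · exact absurd ((le_levV_iff D hj x).2 hx) (not_le.2 h)
  · have : D.Om j = ∅ := D.Om_eq_empty (not_le.1 hj)
    have hx' : iterBlockOf j x ∈ D.Om j := hx
    rw [this] at hx'
    exact absurd hx' (Finset.notMem_empty _)

/-- `Ω₁ = T` gives `1 ≤ j(x)`. [cite: Balaban1984PropagatorsII, p.224 («we admit the case when some domains Ω_j are equal to T_η»)] -/
theorem one_le_levV (h1 : D.Om 1 = Finset.univ) (hk : 1 ≤ D.k) (x : Site (PV d ℓ m K hd hL) 0) : 1 ≤ levV D x :=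
  (le_levV_iff D hk x).2 (by show iterBlockOf 1 x ∈ D.Om 1; rw [h1]; exact Finset.mem_univ _)

end Level

/-! ## §3 Cross-level distances: the reverse inequality and the chart -/

section Dist

variable {P : Params} {j : ℕ}

/-- **ONE LEVEL OF BLOCKING, REVERSE DIRECTION, COORDINATEWISE**: `L·|B(y)_μ − B(c)_μ|_∘ ≤ |y_μ − c_μ|_∘ + (L − 1)` (`j + 1 ≤ m + K`). [folklore] -/
theorem mul_natAbs_valMinAbs_blockOf_le (hj : j + 1 ≤ P.m + P.K) (y c : Site P j) (μ : Fin P.d) :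
    P.L * (((blockOf y) μ - (blockOf c) μ).valMinAbs).natAbs ≤ ((y μ - c μ).valMinAbs).natAbs + (P.L - 1) := by
  have hLpos : 0 < P.L := P.L_pos
  have hN : P.sitesPerDir j = P.sitesPerDir (j + 1) * P.L := P.sitesPerDir_eq_mul_succ hj
  set a : ℕ := (y μ).val with ha
  set b : ℕ := (c μ).val with hb
  have hA : ((blockOf y) μ).val = a / P.L := Site.val_blockOf hj y μ
  have hB : ((blockOf c) μ).val = b / P.L := Site.val_blockOf hj c μ
  set z : ℤ := ((y μ - c μ).valMinAbs : ℤ) with hz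
  -- `z ≡ a − b (mod N_j)`
  have hz' : ((z : ℤ) : ZMod (P.sitesPerDir j)) = (((a : ℤ) - (b : ℤ) : ℤ) : ZMod (P.sitesPerDir j)) := by
    rw [hz, ZMod.coe_valMinAbs, Int.cast_sub, Int.cast_natCast, Int.cast_natCast, ha, hb, ZMod.natCast_zmod_val, ZMod.natCast_zmod_val]
  obtain ⟨t, ht⟩ := (ZMod.intCast_eq_intCast_iff_dvd_sub _ _ _).1 hz'
  -- `z = L·q + r` with `q ≡ a/L − b/L (mod N_{j+1})`, `|r| ≤ L − 1`
  set q : ℤ := ((a / P.L : ℕ) : ℤ) - ((b / P.L : ℕ) : ℤ) - (P.sitesPerDir (j + 1) : ℤ) * t with hq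
  set r : ℤ := ((a % P.L : ℕ) : ℤ) - ((b % P.L : ℕ) : ℤ) with hr
  have hda := Nat.div_add_mod a P.L
  have hdb := Nat.div_add_mod b P.L
  have hzqr : z = (P.L : ℤ) * q + r := by
    have h1 : (a : ℤ) = (P.L : ℤ) * ((a / P.L : ℕ) : ℤ) + ((a % P.L : ℕ) : ℤ) := by exact_mod_cast hda.symm
    have h2 : (b : ℤ) = (P.L : ℤ) * ((b / P.L : ℕ) : ℤ) + ((b % P.L : ℕ) : ℤ) := by exact_mod_cast hdb.symm
    have h3 : (P.sitesPerDir j : ℤ) = (P.sitesPerDir (j + 1) : ℤ) * (P.L : ℤ) := by exact_mod_cast hN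
    have ht' : ((a : ℤ) - (b : ℤ)) - z = (P.sitesPerDir j : ℤ) * t := by linarith [ht]
    rw [hq, hr]
    linear_combination (-1 : ℤ) * ht' + h1 - h2 - t * h3
  -- minimality of `valMinAbs` at level `j + 1`
  have hqc : ((((blockOf y) μ - (blockOf c) μ).valMinAbs : ℤ) : ZMod (P.sitesPerDir (j + 1))) = ((q : ℤ) : ZMod (P.sitesPerDir (j + 1))) := by
    rw [ZMod.coe_valMinAbs, hq, Int.cast_sub, Int.cast_sub, Int.cast_mul, Int.cast_natCast, Int.cast_natCast, Int.cast_natCast,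
      ZMod.natCast_self, zero_mul, sub_zero, ← hA, ← hB, ZMod.natCast_zmod_val, ZMod.natCast_zmod_val]
  have hmin := ZMod.natAbs_min_of_le_div_two (P.sitesPerDir (j + 1)) _ q hqc (ZMod.natAbs_valMinAbs_le _)
  have hra : a % P.L < P.L := Nat.mod_lt a hLpos
  have hrb : b % P.L < P.L := Nat.mod_lt b hLpos
  have hrabs : r.natAbs ≤ P.L - 1 := by rw [hr]; omega
  have hzabs : P.L * q.natAbs ≤ z.natAbs + (P.L - 1) := by
    have h1 : ((P.L : ℤ) * q).natAbs = P.L * q.natAbs := by rw [Int.natAbs_mul, Int.natAbs_natCast]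
    have h2 : ((P.L : ℤ) * q).natAbs ≤ (z).natAbs + r.natAbs := by
      have : (P.L : ℤ) * q = z - r := by rw [hzqr]; ring
      rw [this]
      exact Int.natAbs_sub_le z r
    omega
  calc P.L * (((blockOf y) μ - (blockOf c) μ).valMinAbs).natAbs ≤ P.L * q.natAbs := Nat.mul_le_mul_left _ hmin
    _ ≤ z.natAbs + (P.L - 1) := hzabs

/-- **THE REVERSE CROSS-LEVEL DISTANCE INEQUALITY**: `L·dist_{j+1}(B(y), B(c)) ≤ dist_j(y, c) + (L − 1)` (`j + 1 ≤ m + K`). [folklore] -/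
theorem mul_distSite_blockOf_le (hj : j + 1 ≤ P.m + P.K) (y c : Site P j) :
    (P.L : ℝ) * distSite (Mk P (j + 1)) (blockOf y) (blockOf c) ≤ distSite (Mk P j) y c + ((P.L : ℝ) - 1) := by
  unfold distSite
  have key : P.L * (Finset.univ.sup fun μ : Fin P.d => (((blockOf y) μ - (blockOf c) μ).valMinAbs).natAbs) ≤
      (Finset.univ.sup fun μ : Fin P.d => ((y μ - c μ).valMinAbs).natAbs) + (P.L - 1) := by
    haveI : Nonempty (Fin P.d) := ⟨⟨0, P.hd⟩⟩
    obtain ⟨μ, -, hμ⟩ := Finset.exists_mem_eq_sup (Finset.univ : Finset (Fin P.d)) Finset.univ_nonempty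
      (fun μ : Fin P.d => (((blockOf y) μ - (blockOf c) μ).valMinAbs).natAbs)
    rw [hμ]
    refine (mul_natAbs_valMinAbs_blockOf_le hj y c μ).trans ?_
    exact Nat.add_le_add_right (Finset.le_sup (f := fun μ : Fin P.d => ((y μ - c μ).valMinAbs).natAbs) (Finset.mem_univ μ)) _
  have hcast := (Nat.cast_le (α := ℝ)).2 key
  have hsub : ((P.L - 1 : ℕ) : ℝ) = (P.L : ℝ) - 1 := by rw [Nat.cast_sub P.L_pos, Nat.cast_one]
  simpa [Nat.cast_add, Nat.cast_mul, hsub] using hcast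

/-- **ITERATED**: `L^j·dist_j(B^j x, B^j x′) ≤ dist₀(x, x′) + (L^j − 1)` (`j ≤ m + K`). [folklore] -/
theorem pow_mul_distSite_iterBlockOf_le : ∀ (j : ℕ), j ≤ P.m + P.K → ∀ (x x' : Site P 0),
    (P.L : ℝ) ^ j * distSite (Mk P j) (iterBlockOf j x) (iterBlockOf j x') ≤ distSite (Mk P 0) x x' + ((P.L : ℝ) ^ j - 1)
  | 0, _, x, x' => by simp [iterBlockOf_zero]
  | j + 1, hj, x, x' => by
    have ih := pow_mul_distSite_iterBlockOf_le j (by omega) x x'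
    have h1 := mul_distSite_blockOf_le hj (iterBlockOf j x) (iterBlockOf j x')
    have hL0 : (0 : ℝ) ≤ (P.L : ℝ) ^ j := by positivity
    rw [iterBlockOf_succ, iterBlockOf_succ, pow_succ, mul_assoc]
    calc (P.L : ℝ) ^ j * ((P.L : ℝ) * distSite (Mk P (j + 1)) (blockOf (iterBlockOf j x)) (blockOf (iterBlockOf j x')))
        ≤ (P.L : ℝ) ^ j * (distSite (Mk P j) (iterBlockOf j x) (iterBlockOf j x') + ((P.L : ℝ) - 1)) := mul_le_mul_of_nonneg_left h1 hL0
      _ = (P.L : ℝ) ^ j * distSite (Mk P j) (iterBlockOf j x) (iterBlockOf j x') + ((P.L : ℝ) ^ j * (P.L : ℝ) - (P.L : ℝ) ^ j) := by ring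
      _ ≤ distSite (Mk P 0) x x' + ((P.L : ℝ) ^ j - 1) + ((P.L : ℝ) ^ j * (P.L : ℝ) - (P.L : ℝ) ^ j) := by linarith
      _ = distSite (Mk P 0) x x' + ((P.L : ℝ) ^ j * (P.L : ℝ) - 1) := by ring

/-- a strict lower bound by a natural number for the (integer-valued) lattice distance upgrades by one. [folklore] -/
theorem natCast_add_one_le_distSite {dd : ℕ} {N : Fin dd → ℕ} {a : ℕ} {y y' : B5Prop11Plancherel.Tor N}
    (h : (a : ℝ) < distSite N y y') : (a : ℝ) + 1 ≤ distSite N y y' := by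
  unfold distSite at h ⊢
  have h' := (Nat.cast_lt (α := ℝ)).1 h
  exact_mod_cast Nat.succ_le_of_lt h'

variable {Mh k : ℕ} {P' : Fin (d + 1) → ℕ}

/-- **THE FINE DISTANCE IS THE TORUS DISTANCE OF THE CHART POINTS**: `dist₀(x, x′) = torusSupNorm N₀ (toBox x − toBox x′)`. [cite: Balaban1984PropagatorsII, (2.2) p.224, dictionary] -/
theorem distSite_zero_eq_torusSupNorm (hN : ∀ μ, N0 ℓ Mh k P' μ = (PV d ℓ m K hd hL).sitesPerDir 0) (x x' : Site (PV d ℓ m K hd hL) 0) :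
    distSite (Mk (PV d ℓ m K hd hL) 0) x x' = torusSupNorm (N0 ℓ Mh k P') ((toBox hN x : Fin (d + 1) → ℤ) - (toBox hN x' : Fin (d + 1) → ℤ)) := by
  have hMk : Mk (PV d ℓ m K hd hL) 0 = N0 ℓ Mh k P' := funext fun μ => (hN μ).symm
  rw [B5Ineq110P12Lattice.distSite_eq_torusSupNorm]
  have hrep : rep (Mk (PV d ℓ m K hd hL) 0) x - rep (Mk (PV d ℓ m K hd hL) 0) x' =
      (toBox hN x : Fin (d + 1) → ℤ) - (toBox hN x' : Fin (d + 1) → ℤ) := rfl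
  rw [hrep, hMk]

end Dist

/-! ## §4 An admissible V1 family with `Ω₁ = T` IS a torus family, and `domT` of it is the family -/

section TD

variable {Mh k R : ℕ} {P' : Fin (d + 1) → ℕ}

/-- two V1 domain data with the same number of levels and the same `Ω_j` are equal. [cite: Balaban1984PropagatorsII, (2.1) p.224, bookkeeping] -/
theorem domains_ext {P : Params} {D₁ D₂ : Domains P} (hk : D₁.k = D₂.k) (hOm : D₁.Om = D₂.Om) : D₁ = D₂ := by
  cases D₁; cases D₂; cases hk; cases hOm; rfl

/-- the block label of the chart point at the big-block scale: `⌊z_μ/(M_h L^{j+1})⌋ = ⌊(B^j x)_μ / (L·M_h)⌋`. [cite: Balaban1984PropagatorsII, (2.1) p.224, dictionary] -/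
theorem blk_bigSide_ofBox (hN : ∀ μ, N0 ℓ Mh k P' μ = (PV d ℓ m K hd hL).sitesPerDir 0) {j : ℕ} (hj : j ≤ m + K)
    {z : Fin (d + 1) → ℤ} (hz : z ∈ boxDom (N0 ℓ Mh k P')) (μ : Fin (d + 1)) :
    blk (bigSide ℓ Mh j) z μ = ((((iterBlockOf j (ofBox (m := m) (K := K) (hd := hd) (hL := hL) z)) μ).val / ((ℓ + 1) * Mh) : ℕ) : ℤ) := by
  have hb := blk_toBox hN hj (ofBox (m := m) (K := K) (hd := hd) (hL := hL) z)
  rw [toBox_ofBox hN ⟨z, hz⟩] at hb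
  have hμ := congrFun hb μ
  -- `hμ : z μ / L^j = label of the j-block`
  have hμ' : z μ / (((ℓ + 1) ^ j : ℕ) : ℤ) = (((iterBlockOf j (ofBox (m := m) (K := K) (hd := hd) (hL := hL) z)) μ).val : ℤ) := hμ
  have hLj : (0 : ℤ) ≤ (((ℓ + 1) ^ j : ℕ) : ℤ) := Int.natCast_nonneg _
  show z μ / ((bigSide ℓ Mh j : ℕ) : ℤ) = _
  rw [bigSide_eq, Nat.cast_mul, ← Int.ediv_ediv_of_nonneg hLj, hμ', Int.natCast_div, mul_comm Mh (ℓ + 1)]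

/-- **THE TORUS FAMILY OF AN ADMISSIBLE V1 FAMILY WITH `Ω₁ = T`** (`k ≥ 1` levels, big blocks `M = L·M_h`, separation `R`): level function `j(·) ∘ ofBox`;
(2.1) = `Adm22`'s block clause, (2.2) = `Adm22`'s separation clause read through §3. [cite: Balaban1984PropagatorsII, (2.1)-(2.4) p.224] -/
def tdOfAdm (hN : ∀ μ, N0 ℓ Mh k P' μ = (PV d ℓ m K hd hL).sitesPerDir 0) (D : Domains (PV d ℓ m K hd hL)) (hDk : D.k = k)
    (h1 : D.Om 1 = Finset.univ) (hk1 : 1 ≤ k) (hk : k ≤ m + K) (hAdm : Adm22 D R ((ℓ + 1) * Mh)) : TDomains d ℓ Mh k P' R where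
  lev z := levV D (ofBox (m := m) (K := K) (hd := hd) (hL := hL) z)
  one_le_lev z := one_le_levV D h1 (hDk ▸ hk1) _
  lev_le z := (levV_le D _).trans hDk.le
  bigBlocks j hj2 z hz z' hz' hblk := by
    by_cases hjk : j ≤ k
    · have hjD : j ≤ D.k := hDk ▸ hjk
      rw [le_levV_iff D hjD, le_levV_iff D hjD]
      show iterBlockOf j (ofBox z) ∈ D.Om j ↔ iterBlockOf j (ofBox z') ∈ D.Om j
      refine hAdm.1 j (by omega) _ _ fun μ => ?_
      have e1 := blk_bigSide_ofBox (m := m) (K := K) (hd := hd) (hL := hL) hN (hjk.trans hk) hz μ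
      have e2 := blk_bigSide_ofBox (m := m) (K := K) (hd := hd) (hL := hL) hN (hjk.trans hk) hz' μ
      have h := congrFun hblk μ
      rw [e1, e2] at h
      exact_mod_cast h.symm
    · constructor
      · intro h; exact absurd (h.trans ((levV_le D _).trans hDk.le)) hjk
      · intro h; exact absurd (h.trans ((levV_le D _).trans hDk.le)) hjk
  sepT j z hz z' hz' hlt hle := by
    -- `j + 1 ≤ k`
    have hjk : j + 1 ≤ k := hle.trans ((levV_le D _).trans hDk.le)
    have hjmK : j + 1 ≤ m + K := hjk.trans hk
    set s : Site (PV d ℓ m K hd hL) 0 := ofBox z with hs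
    set s' : Site (PV d ℓ m K hd hL) 0 := ofBox z' with hs'
    -- the two hypotheses of (2.2)
    have hin : blockOf (iterBlockOf j s') ∈ D.Om (j + 1) := by
      rw [← iterBlockOf_succ]
      exact (le_levV_iff D (hDk ▸ hjk) s').1 hle
    have hout : iterBlockOf j s ∉ D.Om j := not_inOm_of_levV_lt D hlt
    have hsep := hAdm.2 j (iterBlockOf j s') (iterBlockOf j s) hin hout
    -- `R·M + 1 ≤ dist_j`
    have hsep1 := natCast_add_one_le_distSite hsep
    -- `L^j·dist_j ≤ dist₀ + L^j − 1`
    have hjPV : j ≤ (PV d ℓ m K hd hL).m + (PV d ℓ m K hd hL).K := by change j ≤ m + K; omega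
    have hup := pow_mul_distSite_iterBlockOf_le (P := PV d ℓ m K hd hL) j hjPV s' s
    have hL1 : (1 : ℝ) ≤ ((ℓ + 1 : ℕ) : ℝ) := by exact_mod_cast Nat.succ_pos ℓ
    have hLj : (1 : ℝ) ≤ ((ℓ + 1 : ℕ) : ℝ) ^ j := one_le_pow₀ hL1
    have hd0 : distSite (Mk (PV d ℓ m K hd hL) 0) s' s = torusSupNorm (N0 ℓ Mh k P') (z - z') := by
      rw [distSite_comm, distSite_zero_eq_torusSupNorm hN, hs, hs', toBox_ofBox hN ⟨z, hz⟩, toBox_ofBox hN ⟨z', hz'⟩]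
    rw [← hd0]
    have hbig : ((R * bigSide ℓ Mh j : ℕ) : ℝ) = ((ℓ + 1 : ℕ) : ℝ) ^ j * ((R * ((ℓ + 1) * Mh) : ℕ) : ℝ) := by
      rw [bigSide_eq]; push_cast; ring
    rw [hbig]
    have hLP : ((PV d ℓ m K hd hL).L : ℝ) = ((ℓ + 1 : ℕ) : ℝ) := rfl
    rw [hLP] at hup
    have h2 : ((ℓ + 1 : ℕ) : ℝ) ^ j * (((R * ((ℓ + 1) * Mh) : ℕ) : ℝ) + 1) ≤
        ((ℓ + 1 : ℕ) : ℝ) ^ j * distSite (Mk (PV d ℓ m K hd hL) j) (iterBlockOf j s') (iterBlockOf j s) :=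
      mul_le_mul_of_nonneg_left hsep1 (by positivity)
    rw [mul_add, mul_one] at h2
    linarith [h2, hup, hLj]

/-- **`domT` OF THE TORUS FAMILY IS THE V1 FAMILY**: so every row of the k-level lineage stated for `domT hN D′ hk` holds for the admissible `D` by `rw`.
[cite: Balaban1984PropagatorsII, (2.1)-(2.4) p.224] -/
theorem domT_tdOfAdm (hN : ∀ μ, N0 ℓ Mh k P' μ = (PV d ℓ m K hd hL).sitesPerDir 0) (D : Domains (PV d ℓ m K hd hL)) (hDk : D.k = k)
    (h1 : D.Om 1 = Finset.univ) (hk1 : 1 ≤ k) (hk : k ≤ m + K) (hAdm : Adm22 D R ((ℓ + 1) * Mh)) :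
    domT hN (tdOfAdm hN D hDk h1 hk1 hk hAdm) hk = D := by
  classical
  refine domains_ext (by rw [hDk]; rfl) (funext fun j => ?_)
  ext y
  by_cases hj0 : j = 0
  · subst hj0
    rw [D.Om_zero]
    simp [domT]
  by_cases hjk : j ≤ k
  · have hjD : j ≤ D.k := hDk ▸ hjk
    simp only [domT, hj0, if_false, hjk, if_true, Finset.mem_filter, Finset.mem_univ, true_and]
    constructor
    · intro h
      obtain ⟨x, hx⟩ := B6ScalarChartV1.exists_iterBlockOf_eq (d := d) (ℓ := ℓ) (hd := hd) (hL := hL) (hjk.trans hk) y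
      have := h x hx
      change j ≤ levV D (ofBox (toBox hN x : Fin (d + 1) → ℤ)) at this
      rw [ofBox_toBox hN, le_levV_iff D hjD] at this
      rw [← hx]
      exact this
    · intro hy x hx
      change j ≤ levV D (ofBox (toBox hN x : Fin (d + 1) → ℤ))
      rw [ofBox_toBox hN, le_levV_iff D hjD]
      show iterBlockOf j x ∈ D.Om j
      rw [hx]
      exact hy
  · have hjD : D.k < j := by rw [hDk]; omega
    rw [D.Om_eq_empty hjD]
    simp [domT, hj0, hjk]

end TD

end Summit.QuantumFields.YangMills.Theorems.FlatPortChart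

end
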